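import Mathlib
import Summits.ResolutionOfSingularities.ResolutionOfSingularities.Theorems.HomologicalConductorPersistenceCusp34Range

/-!
# K-C3 §H2L piece K2b (W4.4b): `(z,t)²` consists of CONDUCTOR elements of `k⟦z,t⟧/(z³+t⁴) ↪ k⟦s⟧`

[OURS · L1 w44b] For the injective normalisation `ν̄ : Q = k⟦z,t⟧/(z³ + t⁴) ↪ k⟦s⟧` (bricks 1–4): `ν̄((z,t)) ⊆ (s³)`, hence
`ν̄((z,t)²) ⊆ (s⁶)`, and since `s⁶·k⟦s⟧ ⊆ range ν̄` (brick 5), **every `c ∈ (z,t)²·Q` is a conductor element**: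
`∀ d, ∃ r ∈ Q, ν̄ r = ν̄ c · d` — the hypothesis `hc` of res-type-011's FACT-FREE
`PersistenceConductorStablyAnnihilates.stablyAnnihilates_of_conductor` (with `Algebra Q k⟦s⟧ := (normQuotHom k).toAlgebra`,
`hinj := normQuotHom_injective k`).  NOT a statement of the manuscript under review.
-/

set_option linter.dupNamespace false

noncomputable section

open PowerSeries

namespace Summit.ResolutionOfSingularities.ResolutionOfSingularities.Theorems.HomologicalConductor.Cusp34

universe u

variable (k : Type u) [Field k]

/-- `mk((z,t)) = (z̄, t̄)`. [OURS] -/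
theorem map_mk_span_pair :
    (Ideal.span {(MvPowerSeries.X 0 : MvPowerSeries (Fin 2) k), MvPowerSeries.X 1}).map
        (Ideal.Quotient.mk (Ideal.span {(MvPowerSeries.X 0 ^ 3 + MvPowerSeries.X 1 ^ 4 : MvPowerSeries (Fin 2) k)})) =
      Ideal.span {Ideal.Quotient.mk (Ideal.span {(MvPowerSeries.X 0 ^ 3 + MvPowerSeries.X 1 ^ 4 : MvPowerSeries (Fin 2) k)}) (MvPowerSeries.X 0),
        Ideal.Quotient.mk (Ideal.span {(MvPowerSeries.X 0 ^ 3 + MvPowerSeries.X 1 ^ 4 : MvPowerSeries (Fin 2) k)}) (MvPowerSeries.X 1)} := by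
  rw [Ideal.map_span, Set.image_pair]

/-- `ν̄((z̄, t̄)) ⊆ (s³)`: `ν̄(z̄) = -s⁴`, `ν̄(t̄) = s³`. [OURS] -/
theorem map_normQuotHom_maximal_le :
    (Ideal.span {Ideal.Quotient.mk (Ideal.span {(MvPowerSeries.X 0 ^ 3 + MvPowerSeries.X 1 ^ 4 : MvPowerSeries (Fin 2) k)}) (MvPowerSeries.X 0),
        Ideal.Quotient.mk (Ideal.span {(MvPowerSeries.X 0 ^ 3 + MvPowerSeries.X 1 ^ 4 : MvPowerSeries (Fin 2) k)}) (MvPowerSeries.X 1)}).map (normQuotHom k) ≤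
      Ideal.span {(X : PowerSeries k) ^ 3} := by
  rw [Ideal.map_span, Set.image_pair, Ideal.span_le]
  rintro b (rfl | rfl)
  · rw [SetLike.mem_coe, normQuotHom_mk_X_zero, Ideal.mem_span_singleton]
    exact ⟨-X, by ring⟩
  · rw [SetLike.mem_coe, normQuotHom_mk_X_one, Ideal.mem_span_singleton]

/-- `ν̄((z̄, t̄)²) ⊆ (s⁶)`. [OURS] -/
theorem map_normQuotHom_maximal_sq_le :
    ((Ideal.span {Ideal.Quotient.mk (Ideal.span {(MvPowerSeries.X 0 ^ 3 + MvPowerSeries.X 1 ^ 4 : MvPowerSeries (Fin 2) k)}) (MvPowerSeries.X 0),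
        Ideal.Quotient.mk (Ideal.span {(MvPowerSeries.X 0 ^ 3 + MvPowerSeries.X 1 ^ 4 : MvPowerSeries (Fin 2) k)}) (MvPowerSeries.X 1)}) ^ 2).map (normQuotHom k) ≤
      Ideal.span {(X : PowerSeries k) ^ 6} := by
  rw [Ideal.map_pow]
  calc _ ≤ (Ideal.span {(X : PowerSeries k) ^ 3}) ^ 2 := Ideal.pow_right_mono (map_normQuotHom_maximal_le k) 2
    _ = Ideal.span {(X : PowerSeries k) ^ 6} := by rw [Ideal.span_singleton_pow, ← pow_mul]

/-- **Every `c ∈ (z̄, t̄)²` is a conductor element of `ν̄`**: `ν̄ c · d ∈ range ν̄` for all `d ∈ k⟦s⟧`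
(the hypothesis `hc` of `stablyAnnihilates_of_conductor`). [OURS] -/
theorem exists_normQuotHom_eq_mul_of_mem_sq
    (c : MvPowerSeries (Fin 2) k ⧸ (Ideal.span {(MvPowerSeries.X 0 ^ 3 + MvPowerSeries.X 1 ^ 4 : MvPowerSeries (Fin 2) k)}))
    (hc : c ∈ (Ideal.span {Ideal.Quotient.mk (Ideal.span {(MvPowerSeries.X 0 ^ 3 + MvPowerSeries.X 1 ^ 4 : MvPowerSeries (Fin 2) k)}) (MvPowerSeries.X 0),
        Ideal.Quotient.mk (Ideal.span {(MvPowerSeries.X 0 ^ 3 + MvPowerSeries.X 1 ^ 4 : MvPowerSeries (Fin 2) k)}) (MvPowerSeries.X 1)}) ^ 2)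
    (d : PowerSeries k) :
    ∃ r : MvPowerSeries (Fin 2) k ⧸ (Ideal.span {(MvPowerSeries.X 0 ^ 3 + MvPowerSeries.X 1 ^ 4 : MvPowerSeries (Fin 2) k)}), normQuotHom k r = normQuotHom k c * d := by
  have h6 : normQuotHom k c ∈ Ideal.span {(X : PowerSeries k) ^ 6} :=
    map_normQuotHom_maximal_sq_le k (Ideal.mem_map_of_mem _ hc)
  obtain ⟨e, he⟩ := Ideal.mem_span_singleton'.mp h6
  obtain ⟨F, hF⟩ := X_pow_six_mul_mem_range_normHom k (e * d)
  exact ⟨Ideal.Quotient.mk _ F, by rw [normQuotHom_mk, hF, ← he]; ring⟩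

/-- The same with `c ∈ ((z,t)²).map mk` (011's spelling `((span {X 0, X 1}) ^ 2).map (Ideal.Quotient.mk _)`). [OURS] -/
theorem exists_normQuotHom_eq_mul_of_mem_map_sq
    (c : MvPowerSeries (Fin 2) k ⧸ (Ideal.span {(MvPowerSeries.X 0 ^ 3 + MvPowerSeries.X 1 ^ 4 : MvPowerSeries (Fin 2) k)}))
    (hc : c ∈ ((Ideal.span {(MvPowerSeries.X 0 : MvPowerSeries (Fin 2) k), MvPowerSeries.X 1}) ^ 2).map
        (Ideal.Quotient.mk (Ideal.span {(MvPowerSeries.X 0 ^ 3 + MvPowerSeries.X 1 ^ 4 : MvPowerSeries (Fin 2) k)})))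
    (d : PowerSeries k) :
    ∃ r : MvPowerSeries (Fin 2) k ⧸ (Ideal.span {(MvPowerSeries.X 0 ^ 3 + MvPowerSeries.X 1 ^ 4 : MvPowerSeries (Fin 2) k)}), normQuotHom k r = normQuotHom k c * d := by
  rw [Ideal.map_pow, map_mk_span_pair] at hc
  exact exists_normQuotHom_eq_mul_of_mem_sq k c hc d

/-- Instances: `z̄², z̄t̄, t̄²` are conductor elements. [OURS] -/
theorem exists_normQuotHom_eq_mul_monomial (i j : Fin 2) (d : PowerSeries k) :
    ∃ r : MvPowerSeries (Fin 2) k ⧸ (Ideal.span {(MvPowerSeries.X 0 ^ 3 + MvPowerSeries.X 1 ^ 4 : MvPowerSeries (Fin 2) k)}),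
      normQuotHom k r =
        normQuotHom k (Ideal.Quotient.mk (Ideal.span {(MvPowerSeries.X 0 ^ 3 + MvPowerSeries.X 1 ^ 4 : MvPowerSeries (Fin 2) k)}) (MvPowerSeries.X i * MvPowerSeries.X j)) * d := by
  apply exists_normQuotHom_eq_mul_of_mem_sq
  rw [map_mul, pow_two]
  apply Ideal.mul_mem_mul
  · fin_cases i
    · exact Ideal.subset_span (by simp)
    · exact Ideal.subset_span (by simp)
  · fin_cases j
    · exact Ideal.subset_span (by simp)
    · exact Ideal.subset_span (by simp)

/-- Packaged for `stablyAnnihilates_of_conductor`: with the algebra structure `ν̄.toAlgebra`, `algebraMap = ν̄` is injective and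
every `c ∈ (z̄,t̄)²` satisfies its conductor hypothesis. [OURS] -/
theorem conductor_hypotheses_of_mem_sq
    (c : MvPowerSeries (Fin 2) k ⧸ (Ideal.span {(MvPowerSeries.X 0 ^ 3 + MvPowerSeries.X 1 ^ 4 : MvPowerSeries (Fin 2) k)}))
    (hc : c ∈ (Ideal.span {Ideal.Quotient.mk (Ideal.span {(MvPowerSeries.X 0 ^ 3 + MvPowerSeries.X 1 ^ 4 : MvPowerSeries (Fin 2) k)}) (MvPowerSeries.X 0),
        Ideal.Quotient.mk (Ideal.span {(MvPowerSeries.X 0 ^ 3 + MvPowerSeries.X 1 ^ 4 : MvPowerSeries (Fin 2) k)}) (MvPowerSeries.X 1)}) ^ 2) :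
    letI : Algebra (MvPowerSeries (Fin 2) k ⧸ (Ideal.span {(MvPowerSeries.X 0 ^ 3 + MvPowerSeries.X 1 ^ 4 : MvPowerSeries (Fin 2) k)})) (PowerSeries k) := (normQuotHom k).toAlgebra
    Function.Injective (algebraMap (MvPowerSeries (Fin 2) k ⧸ (Ideal.span {(MvPowerSeries.X 0 ^ 3 + MvPowerSeries.X 1 ^ 4 : MvPowerSeries (Fin 2) k)})) (PowerSeries k)) ∧
      ∀ d : PowerSeries k, ∃ r : MvPowerSeries (Fin 2) k ⧸ (Ideal.span {(MvPowerSeries.X 0 ^ 3 + MvPowerSeries.X 1 ^ 4 : MvPowerSeries (Fin 2) k)}),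
        algebraMap _ (PowerSeries k) r = algebraMap _ (PowerSeries k) c * d :=
  ⟨normQuotHom_injective k, fun d => exists_normQuotHom_eq_mul_of_mem_sq k c hc d⟩

/-! ### The exact range: `range ν = k⟦s³, s⁴⟧ = {d | d₁ = d₂ = d₅ = 0}` -/

/-- Every value of `ψ` (nested form) is a three-term combination `a₀(s³) - s⁴·a₁(s³) + s⁸·a₂(s³)`
(Weierstrass division by `g`, brick 3). [OURS] -/
theorem exists_psi_eq_three_terms (ψ : PowerSeries (PowerSeries k) →+* PowerSeries k)
    (hC : ∀ a : PowerSeries k, ψ (C a) = expand 3 (by norm_num) a) (hX : ψ X = -(X : PowerSeries k) ^ 4)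
    (G : PowerSeries (PowerSeries k)) :
    ∃ a₀ a₁ a₂ : PowerSeries k,
      ψ G = expand 3 (by norm_num) a₀ - X ^ 4 * expand 3 (by norm_num) a₁ + X ^ 8 * expand 3 (by norm_num) a₂ := by
  have H := isWeierstrassDivisorAt_gCusp k
  obtain ⟨hdeg, heq⟩ := H.isWeierstrassDivisionAt_div_mod G
  rw [order_map_gCusp_toNat] at hdeg
  set r := H.mod G
  have hr' : r.natDegree < 3 := by
    rcases eq_or_ne r 0 with h0 | h0
    · rw [h0]; simp
    · have := hdeg
      rw [Polynomial.degree_eq_natDegree h0] at this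
      exact_mod_cast this
  refine ⟨r.coeff 0, r.coeff 1, r.coeff 2, ?_⟩
  rw [heq, map_add, map_mul, psi_gCusp ψ hC hX, zero_mul, zero_add, psi_coe_of_natDegree_lt ψ hC hX r hr']

/-- **`range ν ⊆ {d | d₁ = d₂ = d₅ = 0}`** (the gaps of the semigroup `⟨3,4⟩`). [OURS] -/
theorem coeff_eq_zero_of_mem_range_normHom (d : PowerSeries k) (hd : d ∈ Set.range (normHom k)) :
    coeff 1 d = 0 ∧ coeff 2 d = 0 ∧ coeff 5 d = 0 := by
  obtain ⟨F, rfl⟩ := hd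
  have hψ : normHom k F = psiHom k (nestE k F) := by
    rw [psiHom_apply, RingEquiv.symm_apply_apply]
  obtain ⟨a₀, a₁, a₂, h3⟩ := exists_psi_eq_three_terms k (psiHom k) (psiHom_C k) (psiHom_X k) (nestE k F)
  rw [hψ, h3]
  have e0 := fun m => coeff_X_pow_mul_expand_three a₀ 0 m
  have e1 := fun m => coeff_X_pow_mul_expand_three a₁ 4 m
  have e2 := fun m => coeff_X_pow_mul_expand_three a₂ 8 m
  simp only [pow_zero, one_mul] at e0
  refine ⟨?_, ?_, ?_⟩ <;>
    (rw [map_add, map_sub, e0, e1, e2, if_neg (by omega), if_neg (by omega), if_neg (by omega)]; simp)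

/-- **`{d | d₁ = d₂ = d₅ = 0} ⊆ range ν`**: `d = d₀ + d₃s³ + d₄s⁴ + s⁶·d'`. [OURS] -/
theorem mem_range_normHom_of_coeff_eq_zero (d : PowerSeries k)
    (h1 : coeff 1 d = 0) (h2 : coeff 2 d = 0) (h5 : coeff 5 d = 0) : d ∈ Set.range (normHom k) := by
  -- split off the part of order ≥ 6
  set d' : PowerSeries k := PowerSeries.mk fun n => coeff (n + 6) d with hd'
  have hsplit : d = C (coeff 0 d) + coeff 3 d • X ^ 3 + coeff 4 d • X ^ 4 + X ^ 6 * d' := by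
    ext n
    simp only [map_add, coeff_C, map_smul, coeff_X_pow, smul_eq_mul, mul_ite, mul_one, mul_zero, coeff_X_pow_mul', hd',
      coeff_mk]
    rcases Nat.lt_or_ge n 6 with hn | hn
    · interval_cases n <;> simp [h1, h2, h5]
    · rw [if_neg (by omega), if_neg (by omega), if_neg (by omega), if_pos hn, Nat.sub_add_cancel hn]
      simp
  obtain ⟨F6, hF6⟩ := X_pow_six_mul_mem_range_normHom k d'
  refine ⟨MvPowerSeries.C (coeff 0 d) + coeff 3 d • MvPowerSeries.X 1 - coeff 4 d • MvPowerSeries.X 0 + F6, ?_⟩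
  have hC : normHom k (MvPowerSeries.C (coeff 0 d)) = C (coeff 0 d) := (normHom k).commutes (coeff 0 d)
  rw [map_add, map_sub, map_add, map_smul, map_smul, normHom_X_zero, normHom_X_one, hF6, hC]
  conv_rhs => rw [hsplit]
  simp only [smul_neg, sub_neg_eq_add]

/-- **`range ν = {d | d₁ = d₂ = d₅ = 0}`** (`= k⟦s³, s⁴⟧`, the semigroup ring of `⟨3,4⟩` completed). [OURS] -/
theorem range_normHom_eq :
    Set.range (normHom k) = {d : PowerSeries k | coeff 1 d = 0 ∧ coeff 2 d = 0 ∧ coeff 5 d = 0} := by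
  ext d
  exact ⟨coeff_eq_zero_of_mem_range_normHom k d, fun ⟨h1, h2, h5⟩ => mem_range_normHom_of_coeff_eq_zero k d h1 h2 h5⟩

end Summit.ResolutionOfSingularities.ResolutionOfSingularities.Theorems.HomologicalConductor.Cusp34

end
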